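import Summits.NavierStokesRegularity.NavierStokesRegularity.Theorems.TypeICertificateLadderNoTypeIBlowupTypeIMorrey
import Summits.NavierStokesRegularity.NavierStokesRegularity.Theorems.RellichScarTypeIBlowupProfileZoomLimit
import Summits.NavierStokesRegularity.NavierStokesRegularity.Theorems.TerminalTraceTypeITraceScarL3ExtinctApexTopVanishing
import Literature.Analysis.FluidPDE.Seregin2020AncientLimit
import Literature.Analysis.FluidPDE.LocalTypeICongr
import Literature.Analysis.FluidPDE.NSCriticalClosureBesovKatoClass
import Literature.Analysis.FluidPDE.SuitableWeakRescaling
import Literature.Analysis.FluidPDE.SereginSverakPressureDecayBalls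
import Literature.Analysis.FluidPDE.BesovBlowupRigidity

/-!
# Line `annulus-dichotomy` of `TerminalTrace.TypeITraceScarL3` (stmt-NavierStokesRegularity-18385):
# the extinct Type-I apex with its zoom data, EVENTUAL TYPE-I CONSTANT EXPOSED

Seat nsreg-C26-p1 g2 (cell ns-regularity-ideate), `--supports stmt-NavierStokesRegularity-18385` (helper);
ROUND-27 «THE √2 APEX» T-27.1 (e) (nsreg-p2 g29; DIRECTOR-NS #103 (1)(e)).  `exists_extinctApex_zoomData_unit`
of `…ExtinctApexZoomData` (ns-typeII-p3 g9) RE-RUN VERBATIM with ONE change: the Type-I hypothesis is an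
EVENTUAL RATE WITH A GIVEN CONSTANT `C ≥ 0` (`‖u(t,x)‖ ≤ C/√(T−t)` near `T`) instead of `IsTypeIBlowup u T`,
and the SAME `C` is the rate constant of the extinct apex (at `ν = 1` the vertex frame has `α = R`, `β = R²`,
so `αC/√β = C`; zooms preserve it, `norm_nsZoom_le_rate`; the limit inherits it, `ae_rate_of_zoomLimit`,
`exists_rate_profile_repr`).
* `exists_extinctApex_zoomData_unit_const` — scales `μ_j → 0⁺`, `(U, P, G, M)` with the six apex properties
  (rate `C/√(−s)` WITH THE GIVEN `C`) and the zoom data on every `Q(a)`.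
With it the constant-exposed Stub 2′ of ROUND-27 (package constant `C/√ν`) follows exactly as Stub 2′ did.
WHAT THIS IS NOT: not NS regularity, not item 18385, not T27-A — bookkeeping with the constant named.
[folklore; AlbrittonBarker2019 §3; Seregin2014 §6.6 Prop. 6.20; SereginSverak2002 §4]
-/

noncomputable section

set_option linter.dupNamespace false

namespace Summit.NavierStokesRegularity.NavierStokesRegularity.Theorems.TypeITraceScarL3

open MeasureTheory Set Function Filter Topology TopologicalSpace Metric
open Literature.Analysis.FluidPDE Literature.Analysis.FluidPDE.SereginSverak2009
open scoped NNReal ENNReal InnerProductSpace RealInnerProductSpace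

/-- **The extinct Type-I apex with its zoom data, unit viscosity, eventual Type-I constant `C ≥ 0` exposed**
(module docstring): the six apex properties with RATE CONSTANT `C`, and the zoom data on every `Q(a)`.
[folklore; AlbrittonBarker2019 §3; Seregin2014 §6.6; SereginSverak2002 §4] -/
theorem exists_extinctApex_zoomData_unit_const {T : ℝ} (hT : 0 < T)
    {u : ℝ → EuclideanSpace ℝ (Fin 3) → EuclideanSpace ℝ (Fin 3)} {p : ℝ → EuclideanSpace ℝ (Fin 3) → ℝ}
    (hsol : IsClassicalNSSolutionOn (Ico 0 T) 1 0 u p) (hLH : IsLerayHopfOn T 1 0 (u 0) u)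
    {C : ℝ} (hC0 : 0 ≤ C) (hrateT : ∀ᶠ t in 𝓝[<] T, ∀ x, ‖u t x‖ ≤ C / Real.sqrt (T - t))
    (x₀ : EuclideanSpace ℝ (Fin 3)) (hnotbd : ¬ IsBackwardBoundedAt u T x₀)
    {ρ : ℝ} (hρ : 0 < ρ) (htr : MemLp (u T) 3 (volume.restrict (ball x₀ ρ))) :
    ∃ (μ : ℕ → ℝ) (U : ℝ → EuclideanSpace ℝ (Fin 3) → EuclideanSpace ℝ (Fin 3))
      (P : ℝ → EuclideanSpace ℝ (Fin 3) → ℝ)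
      (G : ℝ → EuclideanSpace ℝ (Fin 3) → EuclideanSpace ℝ (Fin 3) →L[ℝ] EuclideanSpace ℝ (Fin 3))
      (M : ℝ≥0),
      (∀ j, 0 < μ j) ∧ Tendsto μ atTop (𝓝 0) ∧
      (∀ a : ℝ, 0 < a → IsSuitableWeakSolutionInBall a (0 : ℝ × EuclideanSpace ℝ (Fin 3)) U P) ∧
      (∀ a : ℝ, 0 < a →
        HasWeakSpatialGradientOn (parabolicCylinderOpens a (0 : ℝ × EuclideanSpace ℝ (Fin 3))) U G) ∧
      (∀ a : ℝ, 0 < a → typeIBound (parabolicCylinder a (0 : ℝ × EuclideanSpace ℝ (Fin 3))) U P G ≤ M) ∧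
      (∀ s : ℝ, s < 0 → ∀ᵐ y : EuclideanSpace ℝ (Fin 3), ‖U s y‖ ≤ C / Real.sqrt (-s)) ∧
      (∀ φ : EuclideanSpace ℝ (Fin 3) → EuclideanSpace ℝ (Fin 3), ContDiff ℝ (⊤ : ℕ∞) φ →
        HasCompactSupport φ → ∀ ε : ℝ, 0 < ε →
          ∃ s₀ : ℝ, s₀ < 0 ∧ ∀ᵐ s ∂(volume.restrict (Ioo s₀ 0)), |∫ y, ⟪U s y, φ y⟫| ≤ ε) ∧
      IsBackwardSingularPoint U (0 : ℝ × EuclideanSpace ℝ (Fin 3)) ∧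
      (∀ a : ℝ, 0 < a →
        MemLp (uncurry U) 3 (volume.restrict (parabolicCylinder a (0 : ℝ × EuclideanSpace ℝ (Fin 3)))) ∧
        MemLp (uncurry P) (3 / 2)
          (volume.restrict (parabolicCylinder a (0 : ℝ × EuclideanSpace ℝ (Fin 3)))) ∧
        Tendsto (fun j => eLpNorm
            (uncurry ((μ j) • stPull ((μ j) ^ 2) (μ j) T x₀ u) - uncurry U) 3
            (volume.restrict (parabolicCylinder a (0 : ℝ × EuclideanSpace ℝ (Fin 3)))))
          atTop (𝓝 0) ∧
        ∀ g : ℝ × EuclideanSpace ℝ (Fin 3) → ℝ,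
          MemLp g 3 (volume.restrict (parabolicCylinder a (0 : ℝ × EuclideanSpace ℝ (Fin 3)))) →
          Tendsto (fun j => ∫ w' in parabolicCylinder a (0 : ℝ × EuclideanSpace ℝ (Fin 3)),
              ((μ j) ^ 2 • stPull ((μ j) ^ 2) (μ j) T x₀
                (fun t x => p t x - (p t 0 - normalisedPressure (u t) 0))) w'.1 w'.2 * g w')
            atTop (𝓝 (∫ w' in parabolicCylinder a (0 : ℝ × EuclideanSpace ℝ (Fin 3)),
              P w'.1 w'.2 * g w'))) := by
  have hI : IsTypeIBlowup u T := ⟨C, hrateT⟩ -- then verbatim `exists_extinctApex_zoomData_unit`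
  obtain ⟨r₀, M₀, T₁, hr₀, hT₁, hMor⟩ := morrey_of_typeI one_pos hT hsol hLH hI
  obtain ⟨R, α, β, hR, hα, hβ, hβeq, hαeq, hβT, hball, hGv, htypeI⟩ :=
    exists_zoom_typeIBound_lt_top_of_morrey one_pos hT hsol hLH hr₀ hT₁ hMor x₀
  rw [div_one] at hβeq hαeq
  set q : ℝ → EuclideanSpace ℝ (Fin 3) → ℝ :=
    fun t x => p t x - (p t 0 - normalisedPressure (u t) 0) with hq
  set v : ℝ → EuclideanSpace ℝ (Fin 3) → EuclideanSpace ℝ (Fin 3) := α • stPull β R T x₀ u with hv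
  set πv : ℝ → EuclideanSpace ℝ (Fin 3) → ℝ := α ^ 2 • stPull β R T x₀ q with hπv
  set Gv : ℝ → EuclideanSpace ℝ (Fin 3) → EuclideanSpace ℝ (Fin 3) →L[ℝ] EuclideanSpace ℝ (Fin 3) :=
    (α * R) • stPull β R T x₀ (fun t x => fderiv ℝ (u t) x) with hGvdef
  have hsing : IsBackwardSingularPoint v (0 : ℝ × EuclideanSpace ℝ (Fin 3)) := by
    intro r hr
    by_contra hfin
    have hfin' : eLpNorm (uncurry v) ⊤
        (volume.restrict (parabolicCylinder (min r 1) (0 : ℝ × EuclideanSpace ℝ (Fin 3)))) < ⊤ := by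
      refine lt_of_le_of_lt (eLpNorm_mono_measure _ (Measure.restrict_mono ?_ le_rfl))
        (lt_top_iff_ne_top.2 hfin)
      exact SuitableCompactness.parabolicCylinder_zero_mono (le_min hr.le zero_le_one) (min_le_left _ _)
    exact hnotbd (SereginSverak2002.isBackwardBoundedAt_of_zoom hsol x₀ hR hα hβ hβT
      (lt_min hr one_pos) (min_le_right _ _) hfin')
  -- the rate window for the GIVEN constant `C`
  obtain ⟨T₂, hT₂T, hT₂⟩ := mem_nhdsLT_iff_exists_Ioo_subset.1 hrateT
  set δ : ℝ := T - T₂ with hδdef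
  have hδ : 0 < δ := sub_pos.2 hT₂T
  have hrate : ∀ t ∈ Ioo (T - δ) T, ∀ x, Real.sqrt (T - t) * ‖u t x‖ ≤ C := fun t ht x => by
    have hpos : 0 < Real.sqrt (T - t) := Real.sqrt_pos.2 (sub_pos.2 ht.2)
    have h1 := mul_le_mul_of_nonneg_left (hT₂ ⟨by linarith [ht.1], ht.2⟩ x) hpos.le
    rwa [mul_div_cancel₀ _ hpos.ne'] at h1
  set C₁ : ℝ := α * C / Real.sqrt β with hC₁def
  have hC₁ : 0 ≤ C₁ := by positivity
  have hC₁C : C₁ = C := by rw [hC₁def, hαeq, hβeq, Real.sqrt_sq hR.le]; field_simp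
  have hratev : ∀ s ∈ Ioo (-(δ / β)) 0, ∀ y, ‖v s y‖ ≤ C₁ / Real.sqrt (-s) := by
    intro s hs y
    have h1 : -δ < β * s := by
      have h := mul_lt_mul_of_pos_left hs.1 hβ
      rwa [mul_neg, mul_div_cancel₀ _ hβ.ne'] at h
    have h2 : β * s < 0 := mul_neg_of_pos_of_neg hβ hs.2
    have hb := hrate (T + β * s) ⟨by linarith, by linarith⟩ (x₀ + R • y)
    have hsq : Real.sqrt (T - (T + β * s)) = Real.sqrt β * Real.sqrt (-s) := by
      rw [show T - (T + β * s) = β * (-s) by ring, Real.sqrt_mul hβ.le]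
    rw [hsq] at hb
    have hpos : 0 < Real.sqrt (-s) := Real.sqrt_pos.2 (by linarith [hs.2])
    have hposβ : 0 < Real.sqrt β := Real.sqrt_pos.2 hβ
    rw [hv, smul_stPull_apply, norm_smul, Real.norm_of_nonneg hα.le, hC₁def]
    rw [div_div, le_div_iff₀ (by positivity)]
    calc α * ‖u (T + β * s) (x₀ + R • y)‖ * (Real.sqrt β * Real.sqrt (-s))
        = α * (Real.sqrt β * Real.sqrt (-s) * ‖u (T + β * s) (x₀ + R • y)‖) := by ring
      _ ≤ α * C := mul_le_mul_of_nonneg_left hb hα.le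
  have hc : (0 : ℝ) < 1 / 2 := by norm_num
  set v' : ℝ → EuclideanSpace ℝ (Fin 3) → EuclideanSpace ℝ (Fin 3) :=
    (1 / 2 : ℝ) • stPull ((1 / 2 : ℝ) ^ 2) (1 / 2) (0 : ℝ) (0 : EuclideanSpace ℝ (Fin 3)) v with hv'
  set π' : ℝ → EuclideanSpace ℝ (Fin 3) → ℝ :=
    (1 / 2 : ℝ) ^ 2 • stPull ((1 / 2 : ℝ) ^ 2) (1 / 2) (0 : ℝ) (0 : EuclideanSpace ℝ (Fin 3)) πv
    with hπ'
  set G' : ℝ → EuclideanSpace ℝ (Fin 3) → EuclideanSpace ℝ (Fin 3) →L[ℝ] EuclideanSpace ℝ (Fin 3) :=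
    (1 / 2 : ℝ) ^ 2 • stPull ((1 / 2 : ℝ) ^ 2) (1 / 2) (0 : ℝ) (0 : EuclideanSpace ℝ (Fin 3)) Gv
    with hG'def
  have hball' : IsSuitableWeakSolutionInBall 2 0 v' π' := by
    have h := hball.zoomOut hc
    rwa [show (1 : ℝ) / (1 / 2) = 2 by norm_num] at h
  have hG' : HasWeakSpatialGradientOn
      (parabolicCylinderOpens 2 (0 : ℝ × EuclideanSpace ℝ (Fin 3))) v' G' := by
    have h := hGv.stRescale (1 / 2 : ℝ) (pow_pos hc 2) hc (0 : ℝ) (0 : EuclideanSpace ℝ (Fin 3))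
    have hpre : stPreimage ((1 / 2 : ℝ) ^ 2) (1 / 2) (0 : ℝ) (0 : EuclideanSpace ℝ (Fin 3))
        (parabolicCylinderOpens 1 (0 : ℝ × EuclideanSpace ℝ (Fin 3))) =
        parabolicCylinderOpens 2 (0 : ℝ × EuclideanSpace ℝ (Fin 3)) := by
      apply Opens.ext
      rw [coe_stPreimage, coe_parabolicCylinderOpens, coe_parabolicCylinderOpens,
        stAffine_preimage_parabolicCylinder_zero hc, show (1 : ℝ) / (1 / 2) = 2 by norm_num]
    rw [hpre, ← sq] at h
    exact h
  have hI' : typeIBound (parabolicCylinder 1 (0 : ℝ × EuclideanSpace ℝ (Fin 3))) v' π' G' < ⊤ := by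
    have h := typeIBound_nsZoom hc (0 : ℝ) (0 : EuclideanSpace ℝ (Fin 3))
      (parabolicCylinder (1 / 2) (0 : ℝ × EuclideanSpace ℝ (Fin 3))) v πv Gv
    rw [stAffine_preimage_parabolicCylinder_zero hc, show (1 / 2 : ℝ) / (1 / 2) = 1 by norm_num] at h
    rw [hv', hπ', hG'def, h]
    exact htypeI
  have hsing' : IsBackwardSingularPoint v' (0 : ℝ × EuclideanSpace ℝ (Fin 3)) := by
    intro r hr
    rw [hv', eLpNorm_top_nsZoom hc, Seregin2020.stAffine_zero_zero_apply_zero,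
      hsing ((1 / 2) * r) (by positivity)]
    exact ENNReal.mul_top (by simp)
  have hratev' : ∀ s ∈ Ioo (-((δ / β) / (1 / 2 : ℝ) ^ 2)) 0, ∀ y, ‖v' s y‖ ≤ C₁ / Real.sqrt (-s) :=
    fun s hs y => norm_nsZoom_le_rate hc hratev hs y
  have hsqrt2 : Real.sqrt 2 ≤ 2 := by rw [Real.sqrt_le_left (by norm_num)]; norm_num
  have hPQ : parCyl (0 : ℝ × EuclideanSpace ℝ (Fin 3)) 1 ⊆
      parabolicCylinder 2 (0 : ℝ × EuclideanSpace ℝ (Fin 3)) := by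
    intro z hz
    obtain ⟨ht, hx⟩ := hz
    have hx' := spaceCyl_subset_ball (0 : EuclideanSpace ℝ (Fin 3)) zero_le_one hx
    rw [mul_one, mem_ball_zero_iff] at hx'
    simp only [Prod.fst_zero, one_pow, zero_sub, mem_Ioo] at ht
    rw [SuitableCompactness.mem_parabolicCylinder_zero]
    exact ⟨⟨by linarith [ht.1], ht.2⟩, lt_of_lt_of_le hx' hsqrt2⟩
  have hle : parCylOpens (0 : ℝ × EuclideanSpace ℝ (Fin 3)) 1 ≤
      parabolicCylinderOpens 2 (0 : ℝ × EuclideanSpace ℝ (Fin 3)) := fun z hz => hPQ hz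
  have hsw3 : IsSuitableWeakSolutionOn (parCylOpens (0 : ℝ × EuclideanSpace ℝ (Fin 3)) 1) 1 0 v' π' :=
    IsSuitableWeakSolutionOn.mono_holds hball'.1 hle
  have hA3 : ∃ Cc : ℝ≥0, ∀ᵐ t ∂(volume.restrict (Ioo (-1 : ℝ) 0)),
      ∫⁻ x in spaceCyl (0 : EuclideanSpace ℝ (Fin 3)) 1, ‖v' t x‖ₑ ^ 2 ≤ Cc := by
    obtain ⟨Cc, hCc⟩ := hball'.2.1
    refine ⟨Cc, ?_⟩
    have hsub : Ioo (-1 : ℝ) 0 ⊆ Ioo ((0 : ℝ × EuclideanSpace ℝ (Fin 3)).1 - 2 ^ 2)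
        (0 : ℝ × EuclideanSpace ℝ (Fin 3)).1 := by
      intro t ht
      simp only [Prod.fst_zero, zero_sub, mem_Ioo]
      exact ⟨by linarith [ht.1], ht.2⟩
    have hballsub : spaceCyl (0 : EuclideanSpace ℝ (Fin 3)) 1 ⊆
        ball (0 : ℝ × EuclideanSpace ℝ (Fin 3)).2 2 := by
      refine (spaceCyl_subset_ball (0 : EuclideanSpace ℝ (Fin 3)) zero_le_one).trans ?_
      rw [mul_one, Prod.snd_zero]
      exact ball_subset_ball hsqrt2
    filter_upwards [ae_restrict_of_ae_restrict_of_subset hsub hCc] with t ht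
    exact (lintegral_mono_set hballsub).trans ht
  have hG3 : HasWeakSpatialGradientOn (parCylOpens (0 : ℝ × EuclideanSpace ℝ (Fin 3)) 1) v' G' :=
    hG'.mono hle
  have hE3 : ∫⁻ z in parCyl (0 : ℝ × EuclideanSpace ℝ (Fin 3)) 1,
      ENNReal.ofReal (frobeniusNormSq (G' z.1 z.2)) < ⊤ := by
    obtain ⟨G'', hG'', hG''2⟩ := hball'.2.2.1
    have hae := hG'.ae_eq hG''
    rw [coe_parabolicCylinderOpens] at hae
    refine lt_of_le_of_lt (lintegral_mono_set hPQ) ?_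
    have e : ∫⁻ z in parabolicCylinder 2 (0 : ℝ × EuclideanSpace ℝ (Fin 3)),
        ENNReal.ofReal (frobeniusNormSq (G' z.1 z.2)) =
        ∫⁻ z in parabolicCylinder 2 (0 : ℝ × EuclideanSpace ℝ (Fin 3)),
        ENNReal.ofReal (frobeniusNormSq (G'' z.1 z.2)) := by
      refine lintegral_congr_ae ?_
      filter_upwards [hae] with z hz
      have hz' : G' z.1 z.2 = G'' z.1 z.2 := hz
      rw [hz']
    rw [e]
    exact hG''2
  have hp3 : ∫⁻ z in parCyl (0 : ℝ × EuclideanSpace ℝ (Fin 3)) 1,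
      ‖π' z.1 z.2‖ₑ ^ (3 / 2 : ℝ) < ⊤ := by
    obtain ⟨h32, h32', h32r⟩ := threeHalves_facts
    have hm : MemLp (uncurry π') (3 / 2)
        (volume.restrict (parabolicCylinder 2 (0 : ℝ × EuclideanSpace ℝ (Fin 3)))) := hball'.2.2.2
    have h2 := hm.2
    rw [eLpNorm_eq_lintegral_rpow_enorm_toReal (by norm_num) h32', h32r] at h2
    have hfin : ∫⁻ z in parabolicCylinder 2 (0 : ℝ × EuclideanSpace ℝ (Fin 3)),
        ‖uncurry π' z‖ₑ ^ (3 / 2 : ℝ) < ⊤ := by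
      by_contra htop
      rw [not_lt, top_le_iff] at htop
      rw [htop, ENNReal.top_rpow_of_pos (by norm_num)] at h2
      exact lt_irrefl _ h2
    exact lt_of_le_of_lt (lintegral_mono_set hPQ) hfin
  have hI3 : Seregin2020.blowupIndex 0 v' G' < ⊤ := by
    refine lt_of_le_of_lt (Seregin2020.blowupIndex_le_limsup_cknC 0 v' G') (lt_of_le_of_lt ?_ hI')
    refine limsup_le_of_le (by isBoundedDefault) ?_
    filter_upwards [Ioo_mem_nhdsGT (zero_lt_one' ℝ)] with r hr
    exact cknC_le_abScaledSum.trans (abScaledSum_le_typeIBound hr.1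
      (SuitableCompactness.parabolicCylinder_zero_mono hr.1.le hr.2.le))
  obtain ⟨K, κ, lam, w, ϖ, -, hlam, hlam0, hsingw, hlimw⟩ :=
    Seregin2020.exists_ancientLimit hsw3 hA3 hG3 hE3 hp3 hsing' hI3
  have hball1 : IsSuitableWeakSolutionInBall 1 0 v' π' :=
    SuitableCompactness.isSuitableWeakSolutionInBall_of_le_radius hball' (by norm_num) (by norm_num)
  have hG1 : HasWeakSpatialGradientOn
      (parabolicCylinderOpens 1 (0 : ℝ × EuclideanSpace ℝ (Fin 3))) v' G' :=
    hG'.mono (SuitableCompactness.parabolicCylinderOpens_zero_mono (by norm_num) (by norm_num))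
  obtain ⟨hsww, H, hH, h4I⟩ := slab_typeIBound_of_zoomLimit
    (typeIBound (parabolicCylinder 1 (0 : ℝ × EuclideanSpace ℝ (Fin 3))) v' π' G') hI' one_pos
    hball1 hG1 le_rfl hlam hlam0
    (fun a ha => ⟨(hlimw a ha).1, (hlimw a ha).2.1, (hlimw a ha).2.2.1, (hlimw a ha).2.2.2.1⟩)
  have hvm : ∀ a : ℝ, 0 < a → ∀ᶠ j in atTop, AEStronglyMeasurable
      (uncurry ((lam j) • stPull ((lam j) ^ 2) (lam j) (0 : ℝ) (0 : EuclideanSpace ℝ (Fin 3)) v'))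
      (volume.restrict (parabolicCylinder a (0 : ℝ × EuclideanSpace ℝ (Fin 3)))) := by
    intro a ha
    have hev : ∀ᶠ j in atTop, lam j < 1 / a := hlam0 (Iio_mem_nhds (by positivity))
    filter_upwards [hev] with j hj
    have hμ := hlam j
    have h := hG1.stRescale (lam j) (pow_pos hμ 2) hμ (0 : ℝ) (0 : EuclideanSpace ℝ (Fin 3))
    have hsub : parabolicCylinder a (0 : ℝ × EuclideanSpace ℝ (Fin 3)) ⊆
        ((stPreimage ((lam j) ^ 2) (lam j) (0 : ℝ) (0 : EuclideanSpace ℝ (Fin 3))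
          (parabolicCylinderOpens 1 (0 : ℝ × EuclideanSpace ℝ (Fin 3))) :
            Opens (ℝ × EuclideanSpace ℝ (Fin 3))) : Set (ℝ × EuclideanSpace ℝ (Fin 3))) := by
      rw [coe_stPreimage, coe_parabolicCylinderOpens, stAffine_preimage_parabolicCylinder_zero hμ]
      refine SuitableCompactness.parabolicCylinder_zero_mono ha.le ?_
      rw [le_div_iff₀ hμ, mul_comm]
      exact ((lt_div_iff₀ ha).1 hj).le
    exact h.locallyIntegrableOn.aestronglyMeasurable.mono_measure (Measure.restrict_mono hsub le_rfl)
  have hae_rate := ae_rate_of_zoomLimit (by positivity : (0 : ℝ) < (δ / β) / (1 / 2 : ℝ) ^ 2)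
    hratev' hlam hlam0 hvm (fun a ha => ⟨(hlimw a ha).2.1.1, (hlimw a ha).2.2.1⟩)
  have h4top : typeIBound (Iio (0 : ℝ) ×ˢ univ) w ϖ H < ⊤ :=
    lt_of_le_of_lt h4I (ENNReal.mul_lt_top (by simp) hI')
  obtain ⟨w', haew, hsw', hwg', hIw', hdec', hsing''⟩ :=
    exists_rate_profile_repr hC₁ hsww hH h4top hsingw hae_rate
  set I₀ : ℝ≥0 := (typeIBound (parabolicCylinder (1 / 2) (0 : ℝ × EuclideanSpace ℝ (Fin 3))) v πv Gv).toNNReal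
    with hI₀
  have hI₀eq : ((I₀ : ℝ≥0) : ℝ≥0∞) =
      typeIBound (parabolicCylinder (1 / 2) (0 : ℝ × EuclideanSpace ℝ (Fin 3))) v πv Gv :=
    ENNReal.coe_toNNReal htypeI.ne
  have hD : ∀ ρ' : ℝ, 0 < ρ' → ρ' ≤ R / 2 → cknDOsc ρ' ((T : ℝ), x₀) p ≤ I₀ := by
    intro ρ' hρ' hρ'R
    set r : ℝ := ρ' / R with hr
    have hr0 : 0 < r := by positivity
    have hrhalf : r ≤ 1 / 2 := by
      rw [hr, div_le_iff₀ hR]; linarith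
    have hRr : R * r = ρ' := by rw [hr]; field_simp
    have h1 : cknDOsc r (0 : ℝ × EuclideanSpace ℝ (Fin 3)) πv ≤ I₀ := by
      rw [hI₀eq]
      refine le_trans ?_ (abScaledSum_le_typeIBound (u := v) (p := πv) (G := Gv) hr0
        (SuitableCompactness.parabolicCylinder_zero_mono hr0.le hrhalf))
      unfold abScaledSum
      exact le_add_right (le_add_left le_rfl)
    have h2 : cknDOsc r (0 : ℝ × EuclideanSpace ℝ (Fin 3)) πv = cknDOsc ρ' ((T : ℝ), x₀) q := by
      have h := cknDOsc_nsZoom hR hr0 T x₀ (0 : ℝ × EuclideanSpace ℝ (Fin 3)) q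
      rw [hπv, hαeq, hβeq]
      rw [h, hRr]
      congr 1
      ext <;> simp [stAffine]
    have h3 : cknDOsc ρ' ((T : ℝ), x₀) q = cknDOsc ρ' ((T : ℝ), x₀) p := by
      refine cknDOsc_sub_fun_time hρ' (fun t => p t 0 - normalisedPressure (u t) 0) ?_
      refine (ae_restrict_mem measurableSet_Ioo).mono fun t ht => ?_
      have hρ'2 : ρ' ^ 2 ≤ T := by
        have h1' : ρ' ≤ R := by linarith
        have : ρ' ^ 2 ≤ R ^ 2 := pow_le_pow_left₀ hρ'.le h1' 2
        rw [← hβeq] at this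
        exact this.trans hβT
      have htI : t ∈ Ico 0 T := ⟨by simp only at ht; linarith [ht.1], ht.2⟩
      exact ((hsol.contDiff_pressure htI).continuous.continuousOn.integrableOn_compact
        (isCompact_closedBall _ _)).mono_set ball_subset_closedBall
    rw [← h3, ← h2]
    exact h1
  have hFE := tendsto_scaledEnergy_zero_of_memLp_three hρ htr
  have hv1 : v = R • stPull (R ^ 2) R T x₀ u := by rw [hv, hαeq, hβeq]
  set Rj : ℕ → ℝ := fun j => lam j * (1 / 2 * R) with hRj
  have hRjpos : ∀ j, 0 < Rj j := fun j =>
    show 0 < lam j * (1 / 2 * R) from mul_pos (hlam j) (by positivity)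
  have hRj0 : Tendsto Rj atTop (𝓝 0) := by
    have := hlam0.mul_const (1 / 2 * R)
    rwa [zero_mul] at this
  have hzoomj : ∀ j, (lam j) • stPull ((lam j) ^ 2) (lam j) (0 : ℝ) (0 : EuclideanSpace ℝ (Fin 3)) v' =
      (Rj j) • stPull ((Rj j) ^ 2) (Rj j) T x₀ u := by
    intro j
    rw [hv', hv1, zoom_zoom_velocity, zoom_zoom_velocity]
    simp only [hRj, mul_assoc]
  have hMor₀ : ∀ t ∈ Ioo T₁ T, ∀ ρ' : ℝ, 0 < ρ' → ρ' ≤ r₀ →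
      ∫ x in ball x₀ ρ', ‖u t x‖ ^ 2 ≤ M₀ * ρ' := fun t ht ρ' hρ' hρ'r => hMor t ht x₀ ρ' hρ' hρ'r
  have htop_w : ∀ φ : EuclideanSpace ℝ (Fin 3) → EuclideanSpace ℝ (Fin 3), ContDiff ℝ (⊤ : ℕ∞) φ →
      HasCompactSupport φ → ∀ ε : ℝ, 0 < ε →
        ∃ δ' > 0, ∀ᵐ s ∂(volume : Measure ℝ), s ∈ Ioo (-δ') 0 → |∫ y, ⟪w s y, φ y⟫| ≤ ε := by
    intro φ hφ hφc ε hε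
    obtain ⟨Rφ, hRφ⟩ := hφc.isCompact.isBounded.subset_closedBall (0 : EuclideanSpace ℝ (Fin 3))
    set a : ℝ := max 1 (Rφ + 1) with hadef
    have ha1 : 1 ≤ a := le_max_left _ _
    have ha : 0 < a := one_pos.trans_le ha1
    have hφa : tsupport φ ⊆ ball (0 : EuclideanSpace ℝ (Fin 3)) a := fun x hx =>
      (closedBall_subset_ball (by rw [hadef]; exact lt_of_lt_of_le (by linarith) (le_max_right _ _))) (hRφ hx)
    have hw3 := (hlimw a ha).2.1
    have hconv := (hlimw a ha).2.2.1
    simp only [hzoomj] at hconv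
    exact ae_abs_pairing_le_near_top_of_morrey hT hsol hLH x₀ hr₀ hT₁ hMor₀ (by positivity : 0 < R / 2) hD
      hFE hRjpos hRj0 ha1 hw3 hconv hφ hφc hφa hε
  have hQslab : ∀ a : ℝ, parabolicCylinder a (0 : ℝ × EuclideanSpace ℝ (Fin 3)) ⊆
      Iio (0 : ℝ) ×ˢ (univ : Set (EuclideanSpace ℝ (Fin 3))) := fun a => parabolicCylinder_origin_subset_slab a
  have hQle : ∀ a : ℝ, parabolicCylinderOpens a (0 : ℝ × EuclideanSpace ℝ (Fin 3)) ≤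
      slab (EuclideanSpace ℝ (Fin 3)) (Iio 0) isOpen_Iio := by
    intro a z hz
    show z ∈ ((slab (EuclideanSpace ℝ (Fin 3)) (Iio 0) isOpen_Iio : Opens (ℝ × EuclideanSpace ℝ (Fin 3))) :
      Set (ℝ × EuclideanSpace ℝ (Fin 3)))
    rw [coe_slab]
    exact hQslab a hz
  set M : ℝ≥0 := (typeIBound (Iio (0 : ℝ) ×ˢ univ) w' ϖ H).toNNReal with hM
  have hMeq : ((M : ℝ≥0) : ℝ≥0∞) = typeIBound (Iio (0 : ℝ) ×ˢ univ) w' ϖ H := ENNReal.coe_toNNReal hIw'.ne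
  have hslice : ∀ᵐ s ∂(volume.restrict (Iio (0 : ℝ))), ∀ᵐ y : EuclideanSpace ℝ (Fin 3), w s y = w' s y := by
    have h1 : ∀ᵐ z ∂((volume.restrict (Iio (0 : ℝ))).prod (volume : Measure (EuclideanSpace ℝ (Fin 3)))),
        uncurry w z = uncurry w' z := by
      rw [← Measure.restrict_univ (μ := (volume : Measure (EuclideanSpace ℝ (Fin 3)))),
        Measure.prod_restrict, ← Measure.volume_eq_prod]
      exact haew
    exact Measure.ae_ae_of_ae_prod h1
  have hπv1 : πv = R ^ 2 • stPull (R ^ 2) R T x₀ q := by rw [hπv, hαeq, hβeq]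
  have hzoomπ : ∀ j, (lam j) ^ 2 • stPull ((lam j) ^ 2) (lam j) (0 : ℝ) (0 : EuclideanSpace ℝ (Fin 3)) π' =
      (Rj j) ^ 2 • stPull ((Rj j) ^ 2) (Rj j) T x₀ q := by
    intro j
    rw [hπ', hπv1, zoom_zoom_pressure, zoom_zoom_pressure]
    simp only [hRj, mul_assoc]
  refine ⟨Rj, w', ϖ, H, M, hRjpos, hRj0, ?_, ?_, ?_, ?_, ?_, hsing'', ?_⟩
  · -- suitable in every ball: a.e. modification of `w`
    intro a ha
    exact (hlimw a ha).1.congr_ae' (ae_restrict_of_ae_restrict_of_subset (hQslab a) haew)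
      (ae_of_all _ fun _ => rfl)
  · intro a _
    exact hwg'.mono (hQle a)
  · intro a _
    rw [hMeq]
    exact typeIBound_mono (hQslab a)
  · intro s hs
    refine ae_of_all _ fun y => ?_
    have h := hdec' s hs y
    rwa [hC₁C] at h
  · intro φ hφ hφc ε hε
    obtain ⟨δ', hδ', hw⟩ := htop_w φ hφ hφc ε hε
    refine ⟨-δ', by linarith, ?_⟩
    have hw_r : ∀ᵐ s ∂(volume.restrict (Ioo (-δ') 0)), |∫ y, ⟪w s y, φ y⟫| ≤ ε :=
      (ae_restrict_iff' measurableSet_Ioo).2 hw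
    have hsl_r : ∀ᵐ s ∂(volume.restrict (Ioo (-δ') 0)),
        ∀ᵐ y : EuclideanSpace ℝ (Fin 3), w s y = w' s y :=
      ae_restrict_of_ae_restrict_of_subset Ioo_subset_Iio_self hslice
    filter_upwards [hw_r, hsl_r] with s hs hsl
    have e : ∫ y, ⟪w' s y, φ y⟫ = ∫ y, ⟪w s y, φ y⟫ :=
      integral_congr_ae (hsl.mono fun y hy => by simp only [hy])
    rw [e]
    exact hs
  · -- the zoom data on `Q(a)`
    intro a ha
    have haeQ : ∀ᵐ z ∂(volume.restrict (parabolicCylinder a (0 : ℝ × EuclideanSpace ℝ (Fin 3)))),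
        uncurry w z = uncurry w' z := ae_restrict_of_ae_restrict_of_subset (hQslab a) haew
    obtain ⟨hballa, hw3, hconv, hweak, -⟩ := hlimw a ha
    refine ⟨hw3.ae_eq haeQ, hballa.2.2.2, ?_, ?_⟩
    · simp only [hzoomj] at hconv
      refine hconv.congr fun j => eLpNorm_congr_ae ?_
      filter_upwards [haeQ] with z hz
      simp only [Pi.sub_apply, hz]
    · intro g hg
      have h := hweak g hg
      simp only [hzoomπ] at h
      exact h

end Summit.NavierStokesRegularity.NavierStokesRegularity.Theorems.TypeITraceScarL3

end
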